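import Literature.AlgebraicGeometry.Resolution.DiffOpBlowupShiftLaw
import HarnessLib

/-!
# Giraud's shift law for `Diff^{≤ n}` on a blow-up chart: linearity over `q`-th powers is preserved

Topic: `Literature/AlgebraicGeometry/Resolution`. Refinement of `DiffOpBlowupShiftLaw.lean` (Giraud's lemma with
exceptional shift on `S = R[I/a]` and on its localizations `O′`). The operator `Δ` produced there is
`Δ = a^{n−N} · D̃ · (a^N ·)` (restricted to the chart, then localized), `D̃` the extension of `D` to `R[1/a]`; this file
records that the construction PRESERVES COMMUTATION WITH `q`-TH POWERS: if `D` commutes with the multiplications by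
all `yᵠ`, `y ∈ R` (i.e. `D` is linear over the subring generated by `q`-th powers — for `q = pᵉ` in characteristic `p`:
`D` is `ρᵉ(R)`-linear, `ρ` the Frobenius), then `Δ` commutes with the multiplications by all `x′ᵠ`, `x′ ∈ O′`
(so `Δ` is `ρᵉ(O′)`-linear). Indeed `D̃` commutes with `yᵠ` and with `(1/a)ᵠ` (a differential operator of finite
order vanishing on `R` vanishes on the formally unramified `R[1/a]`; inverse rule `[D̃, u⁻¹] = −u⁻¹ [D̃, u] u⁻¹`), hence
with `σᵠ` for every `σ = y/aᵐ ∈ R[I/a]`; the same transport along `S → O′ = M⁻¹S` and `x′ = χ(σ)/χ(τ)`.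

* `blowupAlgebra.exists_isDiffOpLE_shift_pow`, `exists_isDiffOpLE_shift_pow_of_isLocalization_blowupAlgebra`,
  `exists_isDiffOpLE_shift_pow_of_mem_span`, `exists_isDiffOpLE_shift_pow_of_chart` — the statements of
  `DiffOpBlowupShiftLaw.lean` / `DiffOpBlowupStalkShift.lean` with the extra hypothesis `∀ y, [D, yᵠ] = 0` and the
  extra conclusion `∀ x′, [Δ, x′ᵠ] = 0` (`q = 0` recovers the plain statements).
* helpers: `IsDiffOpLE.commMul_algebraMap_eq_zero_of_extends` (commutation with `φ(y)` passes to an extension along a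
  formally unramified algebra), `commMul_eq_zero_mul/_pow/_of_mul_eq_one` (the elements commuting with an operator
  form a submonoid closed under inverses of units).

Motivation (cell `res-hironaka`, row R34 of the campaign D-0089; nothing of the manuscript under adjudication is
asserted): the reading-(i) form «(HGsw)» of the Giraud shift law asks for operators linear over the Frobenius
sandwich bases `ρᵉ(𝒪_{Z,ξ})`, `ρᵉ(𝒪_{Z′,ξ′})`; this is the ring-level input (stalk level:
`DiffOpBlowupStalkShiftPow.lean`).

## Sources

* A. Bravo, M. L. García-Escamilla, O. Villamayor U., arXiv:1107.1797, Lemma 4.6 (Giraud's Lemma) p. 15, and §4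
  (differential operators linear over `pᵉ`-th powers, `Diff_{𝒪^{pᵉ}}`). [BravoGarciaEscamillaVillamayor2012]
* EGA IV₄ (16.8.1), Prop. (16.8.8), Prop. (17.2.1). [EGAIV4]
-/

noncomputable section

open IsLocalization

namespace Literature.AlgebraicGeometry.Resolution

universe u v w w'

/-! ## Elements commuting with an operator -/

section CommZero

variable {k : Type u} [CommRing k] {B : Type v} [CommRing B] [Algebra k B]

/-- If `[T, b] = 0` and `[T, c] = 0` then `[T, b c] = 0`. [cite: EGAIV4, Prop. (16.8.8) (16.8.8.1) p.42 (product rule for the commutators D_a)] -/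
theorem commMul_eq_zero_mul (T : B →ₗ[k] B) {b c : B} (hb : commMul k T b = 0) (hc : commMul k T c = 0) :
    commMul k T (b * c) = 0 := by
  rw [commMul_mul, hb, hc, LinearMap.zero_comp, smul_zero, add_zero]

/-- If `[T, b] = 0` then `[T, bᵐ] = 0`. [cite: EGAIV4, Prop. (16.8.8) (16.8.8.1) p.42 (product rule for the commutators D_a)] -/
theorem commMul_eq_zero_pow (T : B →ₗ[k] B) {b : B} (hb : commMul k T b = 0) (m : ℕ) :
    commMul k T (b ^ m) = 0 := by
  induction m with
  | zero =>
    ext t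
    simp only [pow_zero, commMul_apply, one_mul, LinearMap.zero_apply, sub_self]
  | succ m ih => rw [pow_succ]; exact commMul_eq_zero_mul T ih hb

/-- If `u v = 1` and `[T, v] = 0` then `[T, u] = 0` (`[T, u] = −u [T, v] u`). [cite: EGAIV4, Prop. (16.8.8) (16.8.8.1) p.42 (commutators D_a; inverse of a unit)] -/
theorem commMul_eq_zero_of_mul_eq_one (T : B →ₗ[k] B) {u v : B} (huv : u * v = 1) (hv : commMul k T v = 0) :
    commMul k T u = 0 := by
  rw [commMul_inv_of_mul_eq_one T huv, hv, LinearMap.zero_comp, smul_zero]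

/-- `[c • (T ∘ (c′ ·)), b] = c • ([T, b] ∘ (c′ ·))`. [cite: EGAIV4, Prop. (16.8.8) (16.8.8.1) p.42 (commutators D_a)] -/
theorem commMul_smul_comp_mulLeft (T : B →ₗ[k] B) (c c' b : B) :
    commMul k (c • (T ∘ₗ LinearMap.mulLeft k c')) b = c • (commMul k T b ∘ₗ LinearMap.mulLeft k c') := by
  ext t
  simp only [commMul_apply, LinearMap.smul_apply, LinearMap.comp_apply, LinearMap.mulLeft_apply, smul_eq_mul]
  ring

end CommZero

/-! ## Commutation passes to extensions along formally unramified algebras -/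

section Extends

variable (k : Type u) [CommRing k] {A : Type v} {B : Type w} [CommRing A] [CommRing B] [Algebra k A] [Algebra k B]
  [Algebra A B]

/-- **Commutation with `φ(y)` passes to extensions.** Let `B` be formally unramified over `A` (e.g. a
localization), `T` a `k`-linear differential operator of order `≤ n` of `B` extending the operator `T′` of `A`
(`T(φ x) = φ(T′ x)`). If `[T′, y] = 0` then `[T, φ y] = 0`: the commutator has finite order and vanishes on `φ(A)`.
[cite: EGAIV4, Prop. (16.8.8) p.42–43 with Prop. (17.2.1) (operators vanishing on a formally unramified subalgebra vanish)] -/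
theorem IsDiffOpLE.commMul_algebraMap_eq_zero_of_extends [Algebra.FormallyUnramified A B] {n : ℕ}
    {T : B →ₗ[k] B} (hT : IsDiffOpLE k n T) {T' : A →ₗ[k] A}
    (hext : ∀ x : A, T (algebraMap A B x) = algebraMap A B (T' x)) {y : A} (hy : commMul k T' y = 0) :
    commMul k T (algebraMap A B y) = 0 := by
  refine IsDiffOpLE.eq_zero_of_apply_algebraMap k (A := A) (hT.mono.of_succ (algebraMap A B y)) fun x => ?_
  have h := LinearMap.congr_fun hy x
  rw [commMul_apply, LinearMap.zero_apply] at h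
  rw [commMul_apply, ← map_mul, hext, hext, ← map_mul, ← map_sub, h, map_zero]

end Extends

/-! ## The chart `R[I/a]` -/

section Chart

variable (k : Type u) [CommRing k] {R : Type v} [CommRing R] [Algebra k R] {I : Ideal R} {a : R}

/-- **Giraud's lemma with exceptional shift on `R[I/a]`, preserving linearity over `q`-th powers.** As
`blowupAlgebra.exists_isDiffOpLE_shift` (operators `E`, `Δ` of order `≤ n` of `S = R[I/a]` with `E(r) = aⁿ D(r)` and
`a^N Δ(s) = E(a^N s)`), and moreover: if `[D, yᵠ] = 0` for all `y ∈ R` then `[E, σᵠ] = 0` and `[Δ, σᵠ] = 0` for all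
`σ ∈ S`. [cite: BravoGarciaEscamillaVillamayor2012, Lemma 4.6 p.15 (Giraud's Lemma), with §4 (operators linear over q-th powers), via EGA IV₄ 16.8.8 (b)] -/
theorem blowupAlgebra.exists_isDiffOpLE_shift_pow (ha : a ∈ I) (n N q : ℕ) {D : R →ₗ[k] R}
    (hD : IsDiffOpLE k n D) (hq : ∀ y : R, commMul k D (y ^ q) = 0) :
    ∃ (E Δ : blowupAlgebra I a →ₗ[k] blowupAlgebra I a),
      IsDiffOpLE k n E ∧ IsDiffOpLE k n Δ ∧
      (∀ r : R, E (algebraMap R (blowupAlgebra I a) r) = algebraMap R (blowupAlgebra I a) (a ^ n * D r)) ∧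
      (∀ s : blowupAlgebra I a,
        algebraMap R (blowupAlgebra I a) a ^ N * Δ s = E (algebraMap R (blowupAlgebra I a) a ^ N * s)) ∧
      (∀ σ : blowupAlgebra I a, commMul k E (σ ^ q) = 0) ∧
      ∀ σ : blowupAlgebra I a, commMul k Δ (σ ^ q) = 0 := by
  obtain ⟨D', hD', hext⟩ := exists_isDiffOpLE_extend k a (B := Localization.Away a) hD
  -- `E₀ = aⁿ • D̃` and `Δ₀ = (1/a)^N • E₀ ∘ (a^N ·)` on `L = R[1/a]`
  set aL : Localization.Away a := algebraMap R (Localization.Away a) a with haL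
  set E₀ : Localization.Away a →ₗ[k] Localization.Away a := (aL ^ n) • D' with hE₀
  have hE₀' : IsDiffOpLE k n E₀ := hD'.smul _
  have hE₀_apply : ∀ x, E₀ x = aL ^ n * D' x := fun x => rfl
  set u : Localization.Away a := Away.invSelf a ^ N with hu
  set Δ₀ : Localization.Away a →ₗ[k] Localization.Away a :=
    u • (E₀ ∘ₗ LinearMap.mulLeft k (aL ^ N)) with hΔ₀
  have hΔ₀' : IsDiffOpLE k n Δ₀ := by
    have := (hE₀'.comp (isDiffOpLE_mulLeft (aL ^ N))).smul u
    rwa [add_zero] at this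
  have hΔ₀_apply : ∀ x, Δ₀ x = u * (aL ^ n * D' (aL ^ N * x)) := fun x => rfl
  have hau : aL ^ N * u = 1 := by rw [hu, ← mul_pow, haL, Away.mul_invSelf, one_pow]
  -- `E₀` preserves `S` (key estimate with `t = 0`)
  have hEmem : ∀ s ∈ blowupAlgebra I a, E₀ s ∈ blowupAlgebra I a := by
    intro s hs
    obtain ⟨e, y, hy, rfl⟩ := blowupAlgebra.exists_eq_mul_invSelf_pow I a ha hs
    have hy' : y ∈ I ^ (e + 0) := by rwa [add_zero]
    obtain ⟨s', hs', hs'_eq⟩ := hD.pow_mul_apply_div_mem k hD' hext e 0 hy'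
    rw [hE₀_apply, haL, hs'_eq, pow_zero, one_mul]
    exact hs'
  -- `Δ₀` preserves `S` (key estimate with `t = N`)
  have hΔmem : ∀ s ∈ blowupAlgebra I a, Δ₀ s ∈ blowupAlgebra I a := by
    intro s hs
    obtain ⟨e, y, hy, rfl⟩ := blowupAlgebra.exists_eq_mul_invSelf_pow I a ha hs
    have hy' : a ^ N * y ∈ I ^ (e + N) := by
      rw [add_comm, pow_add]; exact Ideal.mul_mem_mul (Ideal.pow_mem_pow ha N) hy
    obtain ⟨s', hs', hs'_eq⟩ := hD.pow_mul_apply_div_mem k hD' hext e N hy'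
    rw [(algebraMap R (Localization.Away a)).map_mul, (algebraMap R (Localization.Away a)).map_pow,
      mul_assoc] at hs'_eq
    rw [hΔ₀_apply, haL, hs'_eq, ← mul_assoc, mul_comm u, ← haL, hau, one_mul]
    exact hs'
  -- commutation with `q`-th powers on `L`: `D̃` commutes with `yᵠ` and `(1/a)ᵠ`, hence with `σᵠ`, `σ ∈ S`
  haveI : Algebra.FormallyUnramified R (Localization.Away a) :=
    Algebra.FormallyUnramified.of_isLocalization (Submonoid.powers a)
  have hDy : ∀ y : R, commMul k D' (algebraMap R (Localization.Away a) (y ^ q)) = 0 := fun y =>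
    hD'.commMul_algebraMap_eq_zero_of_extends k hext (hq y)
  have hDinv : commMul k D' (Away.invSelf a ^ q) = 0 := by
    refine commMul_eq_zero_of_mul_eq_one D' (v := aL ^ q) ?_ ?_
    · rw [← mul_pow, haL, mul_comm, Away.mul_invSelf, one_pow]
    · rw [haL, ← map_pow]; exact hDy a
  have hDσ : ∀ σ ∈ blowupAlgebra I a, commMul k D' (σ ^ q) = 0 := by
    intro σ hσ
    obtain ⟨e, y, hy, rfl⟩ := blowupAlgebra.exists_eq_mul_invSelf_pow I a ha hσ
    rw [mul_pow, ← map_pow, ← pow_mul, mul_comm e q, pow_mul]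
    exact commMul_eq_zero_mul D' (hDy y) (commMul_eq_zero_pow D' hDinv e)
  have hE₀σ : ∀ σ ∈ blowupAlgebra I a, commMul k E₀ (σ ^ q) = 0 := fun σ hσ => by
    rw [hE₀, commMul_smul_left, hDσ σ hσ, smul_zero]
  have hΔ₀σ : ∀ σ ∈ blowupAlgebra I a, commMul k Δ₀ (σ ^ q) = 0 := fun σ hσ => by
    rw [hΔ₀, commMul_smul_comp_mulLeft, hE₀σ σ hσ, LinearMap.zero_comp, smul_zero]
  -- restrict both operators to `S`
  let E : blowupAlgebra I a →ₗ[k] blowupAlgebra I a :=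
    { toFun := fun s => ⟨E₀ s, hEmem s s.2⟩
      map_add' := fun s s' => Subtype.ext (by simp)
      map_smul' := fun c s => Subtype.ext (by simp) }
  let Δ : blowupAlgebra I a →ₗ[k] blowupAlgebra I a :=
    { toFun := fun s => ⟨Δ₀ s, hΔmem s s.2⟩
      map_add' := fun s s' => Subtype.ext (by simp)
      map_smul' := fun c s => Subtype.ext (by simp) }
  refine ⟨E, Δ, IsDiffOpLE.of_val_eq k (blowupAlgebra I a) hE₀' (fun s => rfl),
    IsDiffOpLE.of_val_eq k (blowupAlgebra I a) hΔ₀' (fun s => rfl), fun r => ?_, fun s => ?_,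
    fun σ => ?_, fun σ => ?_⟩
  · apply Subtype.ext
    change E₀ (algebraMap R (Localization.Away a) r) = algebraMap R (Localization.Away a) (a ^ n * D r)
    rw [hE₀_apply, hext, map_mul, map_pow]
  · apply Subtype.ext
    change algebraMap R (Localization.Away a) a ^ N * Δ₀ s = E₀ (algebraMap R (Localization.Away a) a ^ N * s)
    rw [hΔ₀_apply, ← haL, ← mul_assoc, hau, one_mul, hE₀_apply]
  · ext t
    have h := LinearMap.congr_fun (hE₀σ σ σ.2) (t : Localization.Away a)
    simp only [commMul_apply, LinearMap.zero_apply] at h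
    simpa [commMul_apply, E] using h
  · ext t
    have h := LinearMap.congr_fun (hΔ₀σ σ σ.2) (t : Localization.Away a)
    simp only [commMul_apply, LinearMap.zero_apply] at h
    simpa [commMul_apply, Δ] using h

end Chart

/-! ## Localizations of the chart -/

section Localize

variable (k : Type u) [CommRing k] {R : Type v} [CommRing R] [Algebra k R] {I : Ideal R} {a : R}
variable {O' : Type w} [CommRing O'] [Algebra k O'] [Algebra (blowupAlgebra I a) O']
  [IsScalarTower k (blowupAlgebra I a) O']

/-- **Giraud's shift law on a localization of `R[I/a]`, preserving linearity over `q`-th powers**: as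
`exists_isDiffOpLE_shift_of_isLocalization_blowupAlgebra`, and if `[D, yᵠ] = 0` for all `y ∈ R` then the operator `Δ`
of `O′ = M⁻¹ R[I/a]` satisfies `[Δ, x′ᵠ] = 0` for all `x′ ∈ O′` (`x′ = χ(σ)/χ(τ)`: commutation with `χ(σᵠ)` passes along
the formally unramified `R[I/a] → O′`, with `χ(τ)^{−q}` by the inverse rule).
[cite: BravoGarciaEscamillaVillamayor2012, Lemma 4.6 p.15 (Giraud's Lemma), with §4 (operators linear over q-th powers), localized via EGA IV₄ (16.8.1), (16.8.8), (17.2.1)] -/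
theorem exists_isDiffOpLE_shift_pow_of_isLocalization_blowupAlgebra (M : Submonoid (blowupAlgebra I a))
    [IsLocalization M O'] (ha : a ∈ I) (n N q : ℕ) {D : R →ₗ[k] R} (hD : IsDiffOpLE k n D)
    (hq : ∀ y : R, commMul k D (y ^ q) = 0) :
    ∃ Δ : O' →ₗ[k] O', IsDiffOpLE k n Δ ∧ (∀ x' : O', commMul k Δ (x' ^ q) = 0) ∧
      ∀ (h : R) (w : O'),
        algebraMap (blowupAlgebra I a) O' (algebraMap R (blowupAlgebra I a) h) =
            algebraMap (blowupAlgebra I a) O' (algebraMap R (blowupAlgebra I a) a) ^ N * w →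
        algebraMap (blowupAlgebra I a) O' (algebraMap R (blowupAlgebra I a) a) ^ n *
            algebraMap (blowupAlgebra I a) O' (algebraMap R (blowupAlgebra I a) (D h)) =
          algebraMap (blowupAlgebra I a) O' (algebraMap R (blowupAlgebra I a) a) ^ N * Δ w := by
  obtain ⟨E, Δ, hE, hΔ, hEext, hshift, -, hΔσ⟩ := blowupAlgebra.exists_isDiffOpLE_shift_pow k ha n N q hD hq
  -- localize `E` and `Δ`
  have hEo : IsDiffOpOver k n (algebraLinearMap k (blowupAlgebra I a) O' ∘ₗ E) := hE.isDiffOpOver_comp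
  have hΔo : IsDiffOpOver k n (algebraLinearMap k (blowupAlgebra I a) O' ∘ₗ Δ) := hΔ.isDiffOpOver_comp
  have hE' : IsDiffOpLE k n (diffOpLocalize k O' M hEo) := isDiffOpLE_diffOpLocalize k O' M hEo
  have hΔ' : IsDiffOpLE k n (diffOpLocalize k O' M hΔo) := isDiffOpLE_diffOpLocalize k O' M hΔo
  have hE'_alg : ∀ s, diffOpLocalize k O' M hEo (algebraMap (blowupAlgebra I a) O' s) =
      algebraMap (blowupAlgebra I a) O' (E s) := fun s => by
    rw [diffOpLocalize_algebraMap]; rfl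
  have hΔ'_alg : ∀ s, diffOpLocalize k O' M hΔo (algebraMap (blowupAlgebra I a) O' s) =
      algebraMap (blowupAlgebra I a) O' (Δ s) := fun s => by
    rw [diffOpLocalize_algebraMap]; rfl
  set aO : O' := algebraMap (blowupAlgebra I a) O' (algebraMap R (blowupAlgebra I a) a) with haO
  haveI : Algebra.FormallyUnramified (blowupAlgebra I a) O' := Algebra.FormallyUnramified.of_isLocalization M
  -- the operator identity `aO^N • Δ' = E' ∘ (aO^N ·)`
  have key : (aO ^ N) • diffOpLocalize k O' M hΔo =
      diffOpLocalize k O' M hEo ∘ₗ LinearMap.mulLeft k (aO ^ N) := by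
    refine IsDiffOpLE.eq_of_apply_algebraMap_eq k (A := blowupAlgebra I a) (hΔ'.smul _) ?_ fun s => ?_
    · have := hE'.comp (isDiffOpLE_mulLeft (aO ^ N)); rwa [add_zero] at this
    · simp only [LinearMap.smul_apply, LinearMap.comp_apply, LinearMap.mulLeft_apply, smul_eq_mul]
      rw [hΔ'_alg, haO, ← map_pow, ← map_mul, hshift, ← hE'_alg, map_mul, map_pow]
  -- commutation with `q`-th powers
  have hcomm : ∀ x' : O', commMul k (diffOpLocalize k O' M hΔo) (x' ^ q) = 0 := by
    intro x'
    obtain ⟨⟨σ, τ⟩, hx⟩ := IsLocalization.surj M x'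
    -- `x' χ(τ) = χ(σ)`, `χ(τ)` a unit
    obtain ⟨v, hv⟩ := (IsLocalization.map_units O' τ).exists_right_inv
    have hx' : x' = algebraMap (blowupAlgebra I a) O' σ * v := by
      calc x' = x' * (algebraMap (blowupAlgebra I a) O' τ * v) := by rw [hv, mul_one]
        _ = algebraMap (blowupAlgebra I a) O' σ * v := by rw [← mul_assoc, hx]
    have h1 : commMul k (diffOpLocalize k O' M hΔo) (algebraMap (blowupAlgebra I a) O' (σ ^ q)) = 0 :=
      hΔ'.commMul_algebraMap_eq_zero_of_extends k hΔ'_alg (hΔσ σ)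
    have h2 : commMul k (diffOpLocalize k O' M hΔo) (v ^ q) = 0 := by
      refine commMul_eq_zero_of_mul_eq_one _ (v := algebraMap (blowupAlgebra I a) O' τ ^ q) ?_ ?_
      · rw [← mul_pow, mul_comm, hv, one_pow]
      · rw [← map_pow]
        exact hΔ'.commMul_algebraMap_eq_zero_of_extends k hΔ'_alg (hΔσ τ)
    rw [hx', mul_pow, ← map_pow]
    exact commMul_eq_zero_mul _ h1 h2
  refine ⟨diffOpLocalize k O' M hΔo, hΔ', hcomm, fun h w hw => ?_⟩
  have hkey := LinearMap.congr_fun key w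
  simp only [LinearMap.smul_apply, LinearMap.comp_apply, LinearMap.mulLeft_apply, smul_eq_mul] at hkey
  rw [hkey, ← hw, hE'_alg, hEext, map_mul, map_pow, map_mul, map_pow]

end Localize

/-! ## Change of the exceptional generator; maps through a chart -/

section Generator

variable {k : Type u} {k' : Type v} [CommRing k] [CommRing k'] {O : Type w} {O' : Type w'} [CommRing O]
  [CommRing O'] [Algebra k O] [Algebra k' O'] (φ : O →+* O')

/-- The `q`-linear shift law passes between two generators `z = ε u`, `u = ε′ z` of the same principal ideal
(`Δ_z = εⁿ ε′^N • Δ_u ∘ (ε^N ·)` commutes with whatever `Δ_u` commutes with).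
[cite: BravoGarciaEscamillaVillamayor2012, Lemma 4.6 p.15 (Giraud's Lemma: the statement depends only on the exceptional ideal I(H), not on its generator)] -/
theorem exists_isDiffOpLE_shift_pow_of_mem_span (q : ℕ) {u z ε ε' : O'} (hz : z = ε * u) (hu : u = ε' * z)
    (H : ∀ (n N : ℕ) (D : O →ₗ[k] O), IsDiffOpLE k n D → (∀ y : O, commMul k D (y ^ q) = 0) →
      ∃ Δ : O' →ₗ[k'] O', IsDiffOpLE k' n Δ ∧ (∀ x' : O', commMul k' Δ (x' ^ q) = 0) ∧
        ∀ (h : O) (w : O'), φ h = u ^ N * w → u ^ n * φ (D h) = u ^ N * Δ w)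
    (n N : ℕ) (D : O →ₗ[k] O) (hD : IsDiffOpLE k n D) (hq : ∀ y : O, commMul k D (y ^ q) = 0) :
    ∃ Δ : O' →ₗ[k'] O', IsDiffOpLE k' n Δ ∧ (∀ x' : O', commMul k' Δ (x' ^ q) = 0) ∧
      ∀ (h : O) (w : O'), φ h = z ^ N * w → z ^ n * φ (D h) = z ^ N * Δ w := by
  obtain ⟨Δ, hΔ, hcomm, hlaw⟩ := H n N D hD hq
  refine ⟨(ε ^ n * ε' ^ N) • (Δ ∘ₗ LinearMap.mulLeft k' (ε ^ N)), ?_, fun x' => ?_, fun h w hw => ?_⟩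
  · have := (hΔ.comp (isDiffOpLE_mulLeft (ε ^ N))).smul (ε ^ n * ε' ^ N); rwa [add_zero] at this
  · rw [commMul_smul_comp_mulLeft, hcomm x', LinearMap.zero_comp, smul_zero]
  · have hw' : φ h = u ^ N * (ε ^ N * w) := by rw [hw, hz, mul_pow]; ring
    have h1 := hlaw h (ε ^ N * w) hw'
    simp only [LinearMap.smul_apply, LinearMap.comp_apply, LinearMap.mulLeft_apply, smul_eq_mul]
    calc z ^ n * φ (D h) = ε ^ n * (u ^ n * φ (D h)) := by rw [hz, mul_pow]; ring
      _ = ε ^ n * (u ^ N * Δ (ε ^ N * w)) := by rw [h1]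
      _ = ε ^ n * ((ε' * z) ^ N * Δ (ε ^ N * w)) := by rw [← hu]
      _ = z ^ N * (ε ^ n * ε' ^ N * Δ (ε ^ N * w)) := by rw [mul_pow]; ring

end Generator

section ChartMap

variable {k : Type u} [CommRing k] {R : Type v} {O' : Type w} [CommRing R] [CommRing O'] [Algebra k R]
  [Algebra k O']

/-- **The `q`-linear shift law along a map that factors through a localized chart** (as
`exists_isDiffOpLE_shift_of_chart`, `DiffOpBlowupStalkShift.lean`, with `q`-th powers): `φ : R → O′` compatible with
the `k`-structures, `a ∈ I`, `χ : R[I/a] → O′` over `R` presenting `O′` as `M⁻¹ R[I/a]`, `(z) = I · O′`. If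
`[D, yᵠ] = 0` for all `y` then `Δ` may be taken with `[Δ, x′ᵠ] = 0` for all `x′`.
[cite: BravoGarciaEscamillaVillamayor2012, Lemma 4.6 p.15 (Giraud's Lemma) with §4, localized via StacksProject Tag 0804 / Tag 07Z3 (2)] -/
theorem exists_isDiffOpLE_shift_pow_of_chart (φ : R →+* O') (hφk : ∀ c : k, φ (algebraMap k R c) = algebraMap k O' c)
    {I : Ideal R} {a : R} (ha : a ∈ I) (χ : blowupAlgebra I a →+* O')
    (hχ : ∀ r : R, χ (algebraMap R (blowupAlgebra I a) r) = φ r) (M : Submonoid (blowupAlgebra I a))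
    (hM : @IsLocalization _ _ M O' _ χ.toAlgebra) {z : O'} (hz : Ideal.span {z} = I.map φ) (q : ℕ)
    (n N : ℕ) (D : R →ₗ[k] R) (hD : IsDiffOpLE k n D) (hq : ∀ y : R, commMul k D (y ^ q) = 0) :
    ∃ Δ : O' →ₗ[k] O', IsDiffOpLE k n Δ ∧ (∀ x' : O', commMul k Δ (x' ^ q) = 0) ∧
      ∀ (h : R) (w : O'), φ h = z ^ N * w → z ^ n * φ (D h) = z ^ N * Δ w := by
  letI := χ.toAlgebra
  haveI := hM
  have hφ' : ∀ r : R, algebraMap (blowupAlgebra I a) O' (algebraMap R (blowupAlgebra I a) r) = φ r := hχ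
  haveI : IsScalarTower k (blowupAlgebra I a) O' := by
    refine IsScalarTower.of_algebraMap_eq fun x => ?_
    rw [IsScalarTower.algebraMap_apply k R (blowupAlgebra I a), hφ', hφk]
  have H : ∀ (n N : ℕ) (D : R →ₗ[k] R), IsDiffOpLE k n D → (∀ y : R, commMul k D (y ^ q) = 0) →
      ∃ Δ : O' →ₗ[k] O', IsDiffOpLE k n Δ ∧ (∀ x' : O', commMul k Δ (x' ^ q) = 0) ∧
        ∀ (h : R) (w : O'), φ h = φ a ^ N * w → φ a ^ n * φ (D h) = φ a ^ N * Δ w := by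
    intro n N D hD hq
    obtain ⟨Δ, hΔ, hcomm, hlaw⟩ :=
      exists_isDiffOpLE_shift_pow_of_isLocalization_blowupAlgebra k (O' := O') M ha n N q hD hq
    refine ⟨Δ, hΔ, hcomm, fun h w hw => ?_⟩
    have := hlaw h w (by rw [hφ', hφ']; exact hw)
    rwa [hφ', hφ'] at this
  have hu : I.map φ = Ideal.span {φ a} := by
    have hcomp : (algebraMap (blowupAlgebra I a) O').comp (algebraMap R (blowupAlgebra I a)) = φ :=
      RingHom.ext hφ'
    conv_lhs => rw [← hcomp, ← Ideal.map_map]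
    rw [map_blowupAlgebra_eq_span ha, Ideal.map_span, Set.image_singleton, hφ']
  rw [hu] at hz
  have hz1 : z ∈ Ideal.span {φ a} := hz ▸ Ideal.mem_span_singleton_self z
  have hz2 : φ a ∈ Ideal.span {z} := hz.symm ▸ Ideal.mem_span_singleton_self (φ a)
  obtain ⟨ε₁, hε₁⟩ := Ideal.mem_span_singleton'.mp hz1
  obtain ⟨ε₂, hε₂⟩ := Ideal.mem_span_singleton'.mp hz2
  exact exists_isDiffOpLE_shift_pow_of_mem_span φ q hε₁.symm hε₂.symm H n N D hD hq

end ChartMap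

end Literature.AlgebraicGeometry.Resolution

end
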